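import Literature.Algebra.Lie.LefschetzInvariantFormParity
import Literature.Algebra.Lie.LefschetzSl2Type
import Literature.Algebra.Lie.LefschetzPrimitiveDecomposition
import HarnessLib

/-!
# The degree dimensions `dim M_j` are even in the orthogonal odd-parity and symplectic even-parity cases (Looijenga–Lunts 1997, §1 (1.16))

Topic `Literature/Algebra/Lie` (namespace `Literature.Algebra.Lie`).  Lane `lit-hodgefound` (Track 2 foundations
library), skeleton seat `lit-hodgefound-skel-1` (generation 44), row **A1-131** of
`run/shared/lean/pub/lit-hodgefound/SKELETON.md`: the sentence of Looijenga–Lunts (1.16) following the parity remark —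
"By the remark above, the `d_i`'s must all be even in the orthogonal cases with odd parity and in the symplectic cases
with even parity" (`d_t = dim V_{-n+2t}`) — as a consequence of A1-125 `LefschetzInvariantFormParity.lean` (the
multiplicities `dim P_{-k}` are even when `ε(-1)^k = -1`) and the multiplicity count
`dim M_{-j} = dim P_{-j} + dim P_{-j-2} + ⋯` (A1-113 `LefschetzSl2Type.lean`, `finrank_degreeSpace_neg_eq_add`).  In the
vocabulary of the series: `(M, h)` `ℤ`-graded with a Lefschetz operator `e` (`HasLefschetzProperty h e`),
finite-dimensional over a field of characteristic `0`, an invariant (`h`-, `e`-skew-adjoint) non-degenerate form `φ`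
with `φᵀ = εφ`; then `dim M_{-j}` and `dim M_j` are EVEN for every `j` with `ε(-1)^j = -1` — i.e. for `j` odd when
`φ` is symmetric ("orthogonal cases with odd parity") and for `j` even when `φ` is skew ("symplectic cases with even
parity").  THEOREMS ONLY; no definition, no named fact, no `sorry` (D-0026 net debt `0`).

## Source, VERBATIM

E. Looijenga, V. A. Lunts, *A Lie algebra attached to a projective variety*, Invent. Math. **129** (1997) 361–412,
§1 (1.16) (held TeX text `paper:arxiv-alg-geom_9604014`, p0008 L85–L95):

> "The `𝔰𝔩(2)`-triple `(e, h, f)` in `𝔤` determines a primitive decomposition of `V`. According to 1.15 the set of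
> positive integers `i ≥ 0` for which `V(i)` appears in the `𝔰𝔩(2)`-module `V` is of the form `{n, n-2, …, n-2r}`
> (with `n - 2r ≥ 0`). So if we put `k := ⌊n/2⌋`, then the dimensions `d_t := dim V_{-n+2t}` (`i = 0, 1, …, k`) satisfy
> `1 ≤ d_0 < d_1 < ⋯ < d_r = d_{r+1} = ⋯ = d_k`. (*)
> By the remark above, the `d_i`'s must all be even in the orthogonal cases with odd parity and in the symplectic
> cases with even parity."

("the remark above" = p0008 L77–L83, the parity sentences of A1-125/A1-128; "orthogonal (resp. symplectic)
representation": (1.3) p0005 L9–L11, `φ` non-degenerate symmetric (resp. skew-symmetric) and invariant.)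
And (1.16), Case `B_l`, p0009 L1–L2: "Case `B_l`. Since `dim V = 2l+1`, its parity must be even. This means that `n`
is even and `d_k` is odd".

## Rendering (dictionary)

* `V` with the grading of `h` and the triple `(e, h, f) ⊂ 𝔤 ⊂ 𝔞𝔲𝔱(V, φ)`: `(M, h)` with `L : HasLefschetzProperty h e`,
  `B : LinearMap.BilinForm K M` non-degenerate with `B.IsSkewAdjoint h`, `B.IsSkewAdjoint e` (the triple lies in
  `𝔞𝔲𝔱(V, φ)`), `B.IsSymm` (orthogonal) resp. `LinearMap.flip B = -B` (symplectic).
* "`d_t = dim V_{-n+2t}`": `finrank K (degreeSpace h m)` for the degrees `m = -j` and `m = j`, `j : ℕ`; "odd parity"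
  makes all occurring `j` odd, "even parity" all occurring `j` even — the theorems below are stated per degree `j` of
  the right parity, which covers both printed cases (degrees of the other parity are `0`-dimensional under the parity
  hypothesis and need no statement).

## Contents (all proved)

* `even_finrank_degreeSpace_neg_of_forall_even` — the counting lemma: if the multiplicities `dim P_{-(j+2t)}`, `t ≥ 0`,
  are all even then `dim M_{-j}` is even (`dim M_{-j} = dim P_{-j} + dim M_{-j-2}`, A1-113, iterated down to
  `M_{-j-2t} = 0`).
* **`even_finrank_degreeSpace_of_flip_eq_smul`** — for `φ` non-degenerate invariant with `φᵀ = εφ` and `ε(-1)^j = -1`: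
  `dim M_{-j}` and `dim M_j` are even (A1-125 `even_finrank_primitiveSpace` for every `k = j + 2t`).
* **`even_finrank_degreeSpace_of_isSymm`** ("orthogonal cases with odd parity": `φ` symmetric, `j` odd) and
  **`even_finrank_degreeSpace_of_flip_eq_neg`** ("symplectic cases with even parity": `φ` skew, `j` even).
* §"total dimension" (APPEND, gen 44, over A1-132 `LefschetzPrimitiveDecomposition.lean`:
  `dim M = Σₖ (k+1) dim P_{-k}`): `even_finrank_of_forall_even_primitive`,
  **`even_finrank_of_isSymm_of_odd_parity`** / **`even_finrank_of_flip_eq_neg_of_even_parity`** (then `dim M`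
  itself is even) and the printed consequence **`not_odd_parity_of_isSymm_of_odd_finrank`** — (1.16) Case `B_l`:
  "Since `dim V = 2l+1`, its parity must be even" (an orthogonal `V` of odd dimension cannot have odd parity).

## SCOPE

(a) The inequalities `(*)` are A1-113/A1-118 (`LefschetzSl2Type.lean` §5) and are not restated.  (b) The case-by-case
use of this parity constraint for `A_l, B_l, C_l, D_l` ((1.16), continued) is not formalised.  (c) Nothing here
concerns complex tori or the Hodge conjecture.

## References

* [LooijengaLunts1997] E. Looijenga, V. A. Lunts, *A Lie algebra attached to a projective variety*, Invent. Math.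
  129 (1997) 361–412; arXiv:alg-geom/9604014. §1 (1.16), p. 8 L77–L95 of the held TeX text, Case `B_l` p. 9
  L1–L2; (1.15) p. 8 L1–L5; (1.3) p. 5 L9–L11.
-/

namespace Literature.Algebra.Lie

open Module Function Set
open LinearMap (BilinForm)
open HasLefschetzProperty (primitiveSpace mem_primitiveSpace_iff)

variable {K : Type*} [Field K] [CharZero K] {M : Type*} [AddCommGroup M] [Module K M] [FiniteDimensional K M]
  {B : BilinForm K M} {h e : Module.End K M}

/-- **Counting lemma: if every multiplicity `dim P_{-(j+2t)}` (`t ≥ 0`) is even, then `dim M_{-j}` is even** —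
`dim M_{-j} = dim P_{-j} + dim M_{-j-2}` (A1-113 `finrank_degreeSpace_neg_eq_add`) iterated until `M_{-j-2t} = 0`
(`j + 2t ≥ dim M`). [cite: LooijengaLunts1997, §1 (1.16) p0008 L85–L95] [cite: LooijengaLunts1997, §1 (1.15) p0008 L1–L5] -/
theorem even_finrank_degreeSpace_neg_of_forall_even (L : HasLefschetzProperty h e) {j : ℕ}
    (hm : ∀ t : ℕ, Even (finrank K (primitiveSpace h e (j + 2 * t)))) :
    Even (finrank K (degreeSpace h (-(j : ℤ)))) := by
  -- induction on the number of steps `n` until `j + 2n ≥ dim M`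
  suffices H : ∀ n j : ℕ, finrank K M ≤ j + 2 * n → (∀ t : ℕ, Even (finrank K (primitiveSpace h e (j + 2 * t)))) →
      Even (finrank K (degreeSpace h (-(j : ℤ)))) from H (finrank K M) j (by omega) hm
  intro n
  induction n with
  | zero =>
    intro j hj _
    rw [L.degreeSpace_eq_bot (n := -(j : ℤ)) (by rw [abs_neg, Nat.abs_cast]; exact_mod_cast (by omega : finrank K M ≤ j)),
      finrank_bot]
    exact Even.zero
  | succ n ih =>
    intro j hj hm
    rw [finrank_degreeSpace_neg_eq_add L j]
    refine Even.add (by simpa using hm 0) ?_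
    have h1 : (-((j : ℤ) + 2) : ℤ) = -((j + 2 : ℕ) : ℤ) := by push_cast; ring
    rw [h1]
    refine ih (j + 2) (by omega) fun t ↦ ?_
    have h2 : j + 2 + 2 * t = j + 2 * (t + 1) := by ring
    rw [h2]
    exact hm (t + 1)

/-- **(1.16): for a non-degenerate invariant form `φ` with `φᵀ = εφ`, the dimensions `dim M_{-j}`, `dim M_j` are even
whenever `ε(-1)^j = -1`** (every `V(j + 2t)` then has even multiplicity by A1-125, and `dim M_{∓j} = Σ_t dim P_{-(j+2t)}`).
[cite: LooijengaLunts1997, §1 (1.16) p0008 L93–L95 ("By the remark above, the d_i's must all be even …")] -/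
theorem even_finrank_degreeSpace_of_flip_eq_smul (hgr : IsZGrading h) (L : HasLefschetzProperty h e)
    (hh : B.IsSkewAdjoint h) (he : B.IsSkewAdjoint e) (hB : B.Nondegenerate) {ε : K}
    (hflip : LinearMap.flip B = ε • B) {j : ℕ} (hε : ε * (-1) ^ j = -1) :
    Even (finrank K (degreeSpace h (-(j : ℤ)))) ∧ Even (finrank K (degreeSpace h (j : ℤ))) := by
  have h1 : Even (finrank K (degreeSpace h (-(j : ℤ)))) :=
    even_finrank_degreeSpace_neg_of_forall_even L fun t ↦
      even_finrank_primitiveSpace h e hgr L hh he hB hflip (k := j + 2 * t)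
        (by rw [pow_add, pow_mul, neg_one_sq, one_pow, mul_one, hε])
  exact ⟨h1, by rwa [finrank_degreeSpace_eq_neg L j]⟩

/-- **"the `d_i`'s must all be even in the orthogonal cases with odd parity"**: for `φ` non-degenerate, invariant and
SYMMETRIC, `dim M_{-j}` and `dim M_j` are even for every ODD `j` (so all `d_t = dim V_{-n+2t}` are even when the
degrees of `V` are odd). [cite: LooijengaLunts1997, §1 (1.16) p0008 L93–L95] -/
theorem even_finrank_degreeSpace_of_isSymm (hgr : IsZGrading h) (L : HasLefschetzProperty h e)
    (hh : B.IsSkewAdjoint h) (he : B.IsSkewAdjoint e) (hB : B.Nondegenerate) (hsymm : B.IsSymm) {j : ℕ}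
    (hj : Odd j) : Even (finrank K (degreeSpace h (-(j : ℤ)))) ∧ Even (finrank K (degreeSpace h (j : ℤ))) := by
  have hflip : LinearMap.flip B = (1 : K) • B := by
    ext x y
    rw [LinearMap.flip_apply, one_smul]
    exact LinearMap.BilinForm.isSymm_def.1 hsymm y x
  exact even_finrank_degreeSpace_of_flip_eq_smul hgr L hh he hB hflip (by rw [hj.neg_one_pow, one_mul])

/-- **"… and in the symplectic cases with even parity"**: for `φ` non-degenerate, invariant and SKEW-SYMMETRIC,
`dim M_{-j}` and `dim M_j` are even for every EVEN `j`. [cite: LooijengaLunts1997, §1 (1.16) p0008 L93–L95] -/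
theorem even_finrank_degreeSpace_of_flip_eq_neg (hgr : IsZGrading h) (L : HasLefschetzProperty h e)
    (hh : B.IsSkewAdjoint h) (he : B.IsSkewAdjoint e) (hB : B.Nondegenerate) (hskew : LinearMap.flip B = -B) {j : ℕ}
    (hj : Even j) : Even (finrank K (degreeSpace h (-(j : ℤ)))) ∧ Even (finrank K (degreeSpace h (j : ℤ))) :=
  even_finrank_degreeSpace_of_flip_eq_smul hgr L hh he hB (ε := -1) (by rw [hskew]; exact (neg_one_smul K B).symm)
    (by rw [hj.neg_one_pow, mul_one])

/-! ### Total dimension (APPEND, gen 44): `dim M` is even in the same cases; (1.16) Case `B_l` -/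

/-- If every multiplicity `dim P_{-k}` is even then `dim M = Σₖ (k+1) dim P_{-k}` (A1-132) is even.
[cite: LooijengaLunts1997, §1 (1.16) p0008 L93–L95] -/
theorem even_finrank_of_forall_even_primitive (hgr : IsZGrading h) (L : HasLefschetzProperty h e)
    (hm : ∀ k : ℕ, Even (finrank K (primitiveSpace h e k))) : Even (finrank K M) := by
  rw [L.finrank_eq_sum_mul_finrank_primitiveSpace' hgr]
  exact Finset.even_sum _ fun k _ ↦ (hm k).mul_left _

/-- **Orthogonal with odd parity ⟹ `dim M` even**: for `φ` non-degenerate, invariant and SYMMETRIC on a module of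
ODD PARITY (`M_m = 0` for every even `m`), `dim M` is even — every `V(k)` with `k` even is absent and every `V(k)`
with `k` odd has even multiplicity (A1-125), so `dim M = Σ (k+1) m_k` is even ("the `d_i`'s must all be even in the
orthogonal cases with odd parity", summed). [cite: LooijengaLunts1997, §1 (1.16) p0008 L93–L95] [cite: LooijengaLunts1997, §1 (1.16) Case B_l, p0009 L1–L2] -/
theorem even_finrank_of_isSymm_of_odd_parity (hgr : IsZGrading h) (L : HasLefschetzProperty h e)
    (hh : B.IsSkewAdjoint h) (he : B.IsSkewAdjoint e) (hB : B.Nondegenerate) (hsymm : B.IsSymm)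
    (hpar : ∀ m : ℤ, Even m → degreeSpace h m = ⊥) : Even (finrank K M) := by
  refine even_finrank_of_forall_even_primitive hgr L fun k ↦ ?_
  rcases Nat.even_or_odd k with hk | hk
  · exact even_finrank_primitiveSpace_of_degreeSpace_eq_bot
      (hpar _ (((Int.even_coe_nat k).2 hk).neg))
  · exact even_finrank_primitiveSpace_of_isSymm h e hgr L hh he hB hsymm hk

/-- **Symplectic with even parity ⟹ `dim M` even**: for `φ` non-degenerate, invariant and SKEW on a module of EVEN
PARITY (`M_m = 0` for every odd `m`), `dim M` is even. [cite: LooijengaLunts1997, §1 (1.16) p0008 L93–L95] -/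
theorem even_finrank_of_flip_eq_neg_of_even_parity (hgr : IsZGrading h) (L : HasLefschetzProperty h e)
    (hh : B.IsSkewAdjoint h) (he : B.IsSkewAdjoint e) (hB : B.Nondegenerate) (hskew : LinearMap.flip B = -B)
    (hpar : ∀ m : ℤ, Odd m → degreeSpace h m = ⊥) : Even (finrank K M) := by
  refine even_finrank_of_forall_even_primitive hgr L fun k ↦ ?_
  rcases Nat.even_or_odd k with hk | hk
  · exact even_finrank_primitiveSpace_of_flip_eq_neg h e hgr L hh he hB hskew hk
  · exact even_finrank_primitiveSpace_of_degreeSpace_eq_bot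
      (hpar _ (((Int.odd_coe_nat k).2 hk).neg))

/-- **(1.16), Case `B_l`: "Since `dim V = 2l+1`, its parity must be even"** — an ORTHOGONAL module (`φ`
non-degenerate, invariant, symmetric) of ODD dimension cannot have odd parity: some even degree `M_m` is non-zero.
[cite: LooijengaLunts1997, §1 (1.16) Case B_l, p0009 L1–L2] -/
theorem not_odd_parity_of_isSymm_of_odd_finrank (hgr : IsZGrading h) (L : HasLefschetzProperty h e)
    (hh : B.IsSkewAdjoint h) (he : B.IsSkewAdjoint e) (hB : B.Nondegenerate) (hsymm : B.IsSymm)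
    (hodd : Odd (finrank K M)) : ∃ m : ℤ, Even m ∧ degreeSpace h m ≠ ⊥ := by
  by_contra hne
  push Not at hne
  exact (Nat.not_even_iff_odd.2 hodd) (even_finrank_of_isSymm_of_odd_parity hgr L hh he hB hsymm hne)

end Literature.Algebra.Lie
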